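import Mathlib
import Summits.NavierStokesRegularity.FluidComputer.BorderedEigenpairSections

/-!
# THEOREM 3-B-NESTED from matrix data, II: the band — head response to the tail (`β_B`), the nested
leak constant (`β_C′` with the `ṽ_t` column), and the tail form split DIAGONAL + PAIRING + CROSS +
RANK-ONE (profile-cert-3 g5, cell `ns-blowup`, 2026-08-26)

HONEST FRAMING (human rulings D-0035/D-0074): nothing here is a claim about Navier–Stokes blow-up.
WHAT THIS IS NOT: not NS evidence. MODEL lane bookkeeping about the FORMAT of the F5 eigenpair
certificates of GROUP B (`CertificateAbcSpectrum*`; cap `SKEWCUT-PAIR.md` §9 (N1)–(N7)). Companion of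
`BorderedEigenpairSections` (same seat): there the head inverse `Ainv` of
`BorderedEigenpairMasterNested.certified_eigenpair_of_row_nested` (p456694) was built from a left
inverse `Binv` of the bordered Galerkin matrix and `hαb` read off `‖Binv‖`. Here the first-order part
`T` is BANDED in the basis — `⟪b i, T x⟫ = Σ_{j ∈ nbr i} t_ij ⟪b j, x⟫`, `nbr` symmetric (locality (F3)
of the certificates: the six-neighbour form of the linearised ABC symbol) — and:

* §1 band bookkeeping (`t_ij = 0` off the band);
* §2 `hβBb`: for a tail vector `w` the head datum `P (R w)` has coordinates `−Σ_{j ∈ nbr i ∖ K} a_ij v_j`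
  (`v = S₀ w`; only the first outer shell `K_out = (⋃_{i∈K} nbr i) ∖ K` is seen), so
  `‖(S₀ ⊕ 1) Ainv (P (R w), 0)‖ ≤ β_B ‖S₀ w‖` follows from the MATRIX bound
  `‖Binv ∘ [−B_K ; 0]‖_{ℓ²(K_out) → ℓ²(K) ⊕ 𝕜} ≤ β_B` (`head_betaB_bound_of_matrix`);
* §3 nested `hβCb`: for a head datum `(y, g)` the vector `(1 − P) R (Ainv (y, g)).1 + ζ • (ṽ − P ṽ)`
  is supported on `K_ext = (K_out ∪ supp ṽ) ∖ K` with coordinates `−(C_K z)_i + ζ ṽ_i`,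
  `(z, ζ) = Binv (ŷ, g)`, so the MATRIX bound `‖[−C_K, ṽ_t] ∘ Binv‖ ≤ β_C′` gives `hβCb`
  (`head_betaC_bound_of_matrix`; (N5) `β_C′ = ‖C E*Â₀⁻¹‖ + ‖ṽ_t‖‖e_μ*Â₀⁻¹‖` is one such bound);
* §4 the tail form of `hcoer` SPLIT: `⟪R w − R a.1 − a.2 • ṽ_t, S₀ w⟫ = ⟪w − (x₀ − λ̃) S₀ w, S₀ w⟫
  − ⟪T w, S₀ w⟫ − ⟪T a′.1, S₀ w⟫ + conj(a′.2) ⟪ṽ_t, S₀ w⟫` (`a = Ainv (P (R w), 0) = −a′`,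
  `a′ = Ainv (P (T w), 0)`), the DIAGONAL part `= Σ_i (Re λ̃ − ℓ_i)|v_i|²` (complex `λ̃`: class I), and
  `tail_coercive_of_structure_nested`: PAIRING bound `s` ((F1)+(F2), Lemma S) + certified SHELL
  inequality (cross term included) + TAIL CONSTANT beyond the shell + the RANK-ONE bound
  `|a′.2| ≤ g_B ‖S₀ w‖` ⇒ `hcoer` with `μ = MU2 − g_B ‖ṽ_t‖` — literally (N4)
  `μ_eff = MU2_b,0 − ‖B*g‖‖ṽ_t‖`.

After this file every hypothesis of p456694 is either automatic in the diagonal setting or a statement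
about FINITE matrices / the model structure (F1)–(F3); the END-TO-END composition is
`BorderedEigenpairFromSections`. Mathlib + `BorderedEigenpairSections`; no new definitions.
bears_on LADDER-NS N5 / Z4-a(1)(2); evidence-only for `EpisodeBase` (stmt-NavierStokesRegularity-19179).
[folklore] throughout.
-/

noncomputable section

namespace Summit.NavierStokesRegularity.FluidComputer.BorderedEigenpairSectionsBand

open Submodule BorderedEigenpairSections
open scoped InnerProductSpace ComplexConjugate

variable {𝕜 H : Type*} [RCLike 𝕜] [NormedAddCommGroup H] [InnerProductSpace 𝕜 H]
variable {ι : Type*} (b : HilbertBasis ι 𝕜 H) [DecidableEq ι]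

/-! ## §1 Band bookkeeping -/

/-- Off the band the matrix entries vanish: `j ∉ nbr i ⇒ ⟪b i, T b j⟫ = 0`. -/
theorem matrix_eq_zero_of_not_mem_band (T : H →L[𝕜] H) (nbr : ι → Finset ι)
    (hTband : ∀ (i : ι) (x : H), ⟪b i, T x⟫_𝕜 = ∑ j ∈ nbr i, ⟪b i, T (b j)⟫_𝕜 * ⟪b j, x⟫_𝕜)
    {i j : ι} (hj : j ∉ nbr i) : ⟪b i, T (b j)⟫_𝕜 = 0 := by
  rw [hTband i (b j)]
  have h : ∀ j' ∈ nbr i, ⟪b i, T (b j')⟫_𝕜 * ⟪b j', b j⟫_𝕜 =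
      if j = j' then ⟪b i, T (b j')⟫_𝕜 else 0 := fun j' _ => by
    rw [(orthonormal_iff_ite.mp b.orthonormal) j' j]
    split_ifs with h1 h2 h2
    · rw [mul_one]
    · exact absurd h1.symm h2
    · exact absurd h2.symm h1
    · rw [mul_zero]
  rw [Finset.sum_congr rfl h, Finset.sum_ite_eq, if_neg hj]

omit [DecidableEq ι] in
/-- Coordinates of `T w` in the `v = S₀ w` measure: `⟪b i, T w⟫ = Σ_{j ∈ nbr i} a_ij ⟪b j, S₀ w⟫`,
`a_ij = t_ij (x₀ − ℓ_j)`. -/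
theorem inner_basis_T_eq_sum_band (ℓ : ι → ℝ) (x₀ : ℝ) (d : lp (fun _ : ι => 𝕜) ⊤)
    (hd : ∀ i, d i * ((x₀ : 𝕜) - (ℓ i : 𝕜)) = 1) (T : H →L[𝕜] H) (nbr : ι → Finset ι)
    (hTband : ∀ (i : ι) (x : H), ⟪b i, T x⟫_𝕜 = ∑ j ∈ nbr i, ⟪b i, T (b j)⟫_𝕜 * ⟪b j, x⟫_𝕜)
    (w : H) (i : ι) :
    ⟪b i, T w⟫_𝕜 = ∑ j ∈ nbr i, (⟪b i, T (b j)⟫_𝕜 * ((x₀ : 𝕜) - (ℓ j : 𝕜))) *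
      ⟪b j, b.diagonalCLM d w⟫_𝕜 := by
  rw [hTband i w]
  refine Finset.sum_congr rfl fun j _ => ?_
  rw [← b.repr_apply_apply (b.diagonalCLM d w), b.diagonalCLM_apply_repr, b.repr_apply_apply,
    mul_assoc, ← mul_assoc ((x₀ : 𝕜) - (ℓ j : 𝕜)), mul_comm ((x₀ : 𝕜) - (ℓ j : 𝕜)), hd, one_mul]

/-! ## §2 The head constant `β_B` (head response to the tail through the band) -/

/-- **`hβBb` of p456694 from matrix data.** Diagonal setting, `T` banded, `w ∈ U_Kᗮ` a tail vector,
`v = S₀ w`: the head datum `P (R w)` has coordinates `ŷ_i = −Σ_{j ∈ nbr i ∖ K} a_ij v_j` (`i ∈ K`);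
hence if `Ainv` acts through `Binv` in coordinates and
`‖Binv (ŷ(e), 0)‖² ≤ β_B² Σ_{j ∈ K_out} |e_j|²` for every coefficient vector `e`
(`K_out = (⋃_{i∈K} nbr i) ∖ K`; the certified `β_B ≥ ‖Â₀⁻¹ [B_K ; 0]‖`), then
`‖(S₀ (Ainv (P (R w), 0)).1, (Ainv (P (R w), 0)).2)‖ ≤ β_B ‖S₀ w‖`. -/
theorem head_betaB_bound_of_matrix [CompleteSpace H] (ℓ : ι → ℝ) (x₀ : ℝ)
    (d : lp (fun _ : ι => 𝕜) ⊤) (hd : ∀ i, d i * ((x₀ : 𝕜) - (ℓ i : 𝕜)) = 1) (T : H →L[𝕜] H)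
    (lt : 𝕜) (K : Finset ι) (nbr : ι → Finset ι)
    (hTband : ∀ (i : ι) (x : H), ⟪b i, T x⟫_𝕜 = ∑ j ∈ nbr i, ⟪b i, T (b j)⟫_𝕜 * ⟪b j, x⟫_𝕜)
    (Binv : ((K → 𝕜) × 𝕜) →ₗ[𝕜] ((K → 𝕜) × 𝕜)) (Ainv : (H × 𝕜) →ₗ[𝕜] (H × 𝕜))
    (hA1 : ∀ (y : H) (g : 𝕜),
      b.diagonalCLM d (Ainv (y, g)).1 = ∑ j : K, (Binv (fun i : K => ⟪b i, y⟫_𝕜, g)).1 j • b j)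
    (hA2 : ∀ (y : H) (g : 𝕜), (Ainv (y, g)).2 = (Binv (fun i : K => ⟪b i, y⟫_𝕜, g)).2)
    {βB : ℝ} (hβB : 0 ≤ βB)
    (hB : ∀ e : ι → 𝕜,
      ∑ j : K, ‖(Binv (fun i : K => -∑ j ∈ nbr i \ K,
          (⟪b i, T (b j)⟫_𝕜 * ((x₀ : 𝕜) - (ℓ j : 𝕜))) * e j, 0)).1 j‖ ^ 2 +
        ‖(Binv (fun i : K => -∑ j ∈ nbr i \ K,
          (⟪b i, T (b j)⟫_𝕜 * ((x₀ : 𝕜) - (ℓ j : 𝕜))) * e j, 0)).2‖ ^ 2 ≤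
        βB ^ 2 * ∑ j ∈ K.biUnion nbr \ K, ‖e j‖ ^ 2) :
    ∀ w ∈ ((span 𝕜 (b '' (K : Set ι))).topologicalClosure)ᗮ,
      ‖WithLp.toLp 2 (b.diagonalCLM d
          (Ainv ((span 𝕜 (b '' (K : Set ι))).topologicalClosure.starProjection
            (((1 : H →L[𝕜] H) - T - ((x₀ : 𝕜) - lt) • b.diagonalCLM d) w), 0)).1,
        (Ainv ((span 𝕜 (b '' (K : Set ι))).topologicalClosure.starProjection
            (((1 : H →L[𝕜] H) - T - ((x₀ : 𝕜) - lt) • b.diagonalCLM d) w), 0)).2)‖ ≤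
      βB * ‖b.diagonalCLM d w‖ := by
  intro w hw
  set U := (span 𝕜 (b '' (K : Set ι))).topologicalClosure with hU
  set S₀ := b.diagonalCLM d with hS₀
  set e : ι → 𝕜 := fun j => ⟪b j, S₀ w⟫_𝕜 with he
  have hSw : S₀ w ∈ Uᗮ := diagonalCLM_mem_orthogonal_closure_span b d K hw
  have hw0 : ∀ i ∈ K, ⟪b i, w⟫_𝕜 = 0 := (mem_orthogonal_closure_span_iff b K w).mp hw
  have hSw0 : ∀ i ∈ K, ⟪b i, S₀ w⟫_𝕜 = 0 := (mem_orthogonal_closure_span_iff b K _).mp hSw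
  -- head coordinates of the datum
  have hcoord : (fun i : K => ⟪b i, U.starProjection
      (((1 : H →L[𝕜] H) - T - ((x₀ : 𝕜) - lt) • S₀) w)⟫_𝕜) =
      fun i : K => -∑ j ∈ nbr i \ K, (⟪b i, T (b j)⟫_𝕜 * ((x₀ : 𝕜) - (ℓ j : 𝕜))) * e j := by
    funext i
    rw [inner_basis_starProjection, if_pos i.2]
    simp only [sub_apply, FunLike.coe_smul, Pi.smul_apply, one_apply_eq_self]
    rw [inner_sub_right, inner_sub_right, inner_smul_right, hw0 i i.2, hSw0 i i.2, mul_zero,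
      sub_zero, zero_sub, inner_basis_T_eq_sum_band b ℓ x₀ d hd T nbr hTband w i, neg_inj]
    refine (Finset.sum_subset Finset.sdiff_subset fun j hj hj' => ?_).symm
    have hjK : j ∈ K := by
      by_contra h
      exact hj' (Finset.mem_sdiff.mpr ⟨hj, h⟩)
    rw [← hS₀, hSw0 j hjK, mul_zero]
  have h2 : ‖WithLp.toLp 2 (S₀ (Ainv (U.starProjection
      (((1 : H →L[𝕜] H) - T - ((x₀ : 𝕜) - lt) • S₀) w), 0)).1,
      (Ainv (U.starProjection (((1 : H →L[𝕜] H) - T - ((x₀ : 𝕜) - lt) • S₀) w), 0)).2)‖ ^ 2 ≤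
      (βB * ‖S₀ w‖) ^ 2 := by
    rw [BorderedHeadTailBound.norm_toLp_sq, hS₀, hA1, hA2, ← hS₀, norm_sq_sum_univ_smul_basis,
      hcoord, mul_pow]
    refine (hB e).trans (mul_le_mul_of_nonneg_left ?_ (sq_nonneg _))
    exact sum_norm_sq_inner_le b _ _
  exact (pow_le_pow_iff_left₀ (norm_nonneg _) (by positivity) two_ne_zero).mp h2

/-! ## §3 The nested leak constant `β_C′` (leak of the head solution + the `ṽ_t` column) -/

/-- **Nested `hβCb` of p456694 from matrix data.** Diagonal setting, `T` banded with symmetric band,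
column vector `ṽ` supported on a finite `K_v` (the float vector at level `K_V`), `Ainv` acting through
`Binv` with head-vector first component `Σ_{j∈K} ((x₀ − ℓ_j) z_j) b_j`, `(z, ζ) = Binv (ŷ, g)`. For a
head datum `(y, g)`, `y ∈ U_K`, the vector `(1 − P) R (Ainv (y, g)).1 + ζ • (ṽ − P ṽ)` is supported on
`K_ext = ((⋃_{j∈K} nbr j) ∪ K_v) ∖ K` with coordinates `−Σ_{j∈K} a_ij z_j + ζ ⟪b i, ṽ⟫`; so the MATRIX
bound `Σ_{i ∈ K_ext} |−(C_K z)_i + ζ ṽ_i|² ≤ β_C² ‖(c, g)‖²` for `(z, ζ) = Binv (c, g)` (the certified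
(N5) `β_C′`) gives `‖(1 − P) R (Ainv (y, g)).1 + ζ • (ṽ − P ṽ)‖ ≤ β_C ‖(y, g)‖`. -/
theorem head_betaC_bound_of_matrix [CompleteSpace H] (ℓ : ι → ℝ) (x₀ : ℝ)
    (d : lp (fun _ : ι => 𝕜) ⊤) (hd : ∀ i, d i * ((x₀ : 𝕜) - (ℓ i : 𝕜)) = 1) (T : H →L[𝕜] H)
    (lt : 𝕜) (K : Finset ι) (nbr : ι → Finset ι) (hsymm : ∀ i j, j ∈ nbr i ↔ i ∈ nbr j)
    (hTband : ∀ (i : ι) (x : H), ⟪b i, T x⟫_𝕜 = ∑ j ∈ nbr i, ⟪b i, T (b j)⟫_𝕜 * ⟪b j, x⟫_𝕜)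
    (vc : H) (Kv : Finset ι) (hvc : ∀ i, i ∉ Kv → ⟪b i, vc⟫_𝕜 = 0)
    (Binv : ((K → 𝕜) × 𝕜) →ₗ[𝕜] ((K → 𝕜) × 𝕜)) (Ainv : (H × 𝕜) →ₗ[𝕜] (H × 𝕜))
    (hA1 : ∀ (y : H) (g : 𝕜), (Ainv (y, g)).1 =
      ∑ j : K, (((x₀ : 𝕜) - (ℓ j : 𝕜)) * (Binv (fun i : K => ⟪b i, y⟫_𝕜, g)).1 j) • b j)
    (hA2 : ∀ (y : H) (g : 𝕜), (Ainv (y, g)).2 = (Binv (fun i : K => ⟪b i, y⟫_𝕜, g)).2)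
    {βC : ℝ} (hβC : 0 ≤ βC)
    (hC : ∀ (c : K → 𝕜) (g : 𝕜),
      ∑ i ∈ (K.biUnion nbr ∪ Kv) \ K,
        ‖-∑ j : K, (⟪b i, T (b j)⟫_𝕜 * ((x₀ : 𝕜) - (ℓ j : 𝕜))) * (Binv (c, g)).1 j +
          (Binv (c, g)).2 * ⟪b i, vc⟫_𝕜‖ ^ 2 ≤ βC ^ 2 * (∑ i : K, ‖c i‖ ^ 2 + ‖g‖ ^ 2)) :
    ∀ y ∈ (span 𝕜 (b '' (K : Set ι))).topologicalClosure, ∀ g : 𝕜,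
      ‖((1 : H →L[𝕜] H) - T - ((x₀ : 𝕜) - lt) • b.diagonalCLM d) (Ainv (y, g)).1 -
          (span 𝕜 (b '' (K : Set ι))).topologicalClosure.starProjection
            (((1 : H →L[𝕜] H) - T - ((x₀ : 𝕜) - lt) • b.diagonalCLM d) (Ainv (y, g)).1) +
          (Ainv (y, g)).2 • (vc - (span 𝕜 (b '' (K : Set ι))).topologicalClosure.starProjection vc)‖ ≤
        βC * ‖WithLp.toLp 2 (y, g)‖ := by
  intro y hy g
  set U := (span 𝕜 (b '' (K : Set ι))).topologicalClosure with hU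
  set R : H →L[𝕜] H := (1 : H →L[𝕜] H) - T - ((x₀ : 𝕜) - lt) • b.diagonalCLM d with hR
  set z : K → 𝕜 := (Binv (fun i : K => ⟪b i, y⟫_𝕜, g)).1 with hz
  set ζ : 𝕜 := (Binv (fun i : K => ⟪b i, y⟫_𝕜, g)).2 with hζ
  set z' : ι → 𝕜 := fun i => if h : i ∈ K then z ⟨i, h⟩ else 0 with hz'
  set X : H := R (Ainv (y, g)).1 - U.starProjection (R (Ainv (y, g)).1) +
    (Ainv (y, g)).2 • (vc - U.starProjection vc) with hX
  -- the head solution as a head vector with extended coordinates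
  have hu' : (Ainv (y, g)).1 = ∑ j ∈ K, (((x₀ : 𝕜) - (ℓ j : 𝕜)) * z' j) • b j := by
    rw [hA1, ← Finset.sum_coe_sort K]
    exact Finset.sum_congr rfl fun j _ => by simp only [hz', dif_pos j.2, ← hz, Subtype.coe_eta]
  have hsumK : ∀ i, ∑ j ∈ K, (⟪b i, T (b j)⟫_𝕜 * ((x₀ : 𝕜) - (ℓ j : 𝕜))) * z' j =
      ∑ j : K, (⟪b i, T (b j)⟫_𝕜 * ((x₀ : 𝕜) - (ℓ j : 𝕜))) * z j := fun i => by
    rw [← Finset.sum_coe_sort K]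
    exact Finset.sum_congr rfl fun j _ => by simp only [hz', dif_pos j.2, Subtype.coe_eta]
  -- coordinates of `X`
  have hXi : ∀ i, ⟪b i, X⟫_𝕜 = if i ∈ K then 0 else
      -∑ j : K, (⟪b i, T (b j)⟫_𝕜 * ((x₀ : 𝕜) - (ℓ j : 𝕜))) * z j + ζ * ⟪b i, vc⟫_𝕜 := by
    intro i
    rw [hX, inner_add_right, inner_sub_right, inner_basis_starProjection, inner_smul_right,
      inner_sub_right, inner_basis_starProjection, hA2, ← hζ]
    split_ifs with hi
    · ring
    · rw [sub_zero, sub_zero, hu', hR, inner_basis_resolventCoord_headVector b ℓ x₀ d hd T lt K z' i,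
        if_neg hi, zero_sub, hsumK]
  -- support of `X`
  have hsupp : ∀ i, i ∉ (K.biUnion nbr ∪ Kv) \ K → ⟪b i, X⟫_𝕜 = 0 := by
    intro i hi
    rw [hXi]
    split_ifs with hiK
    · rfl
    · have hi' : i ∉ K.biUnion nbr ∪ Kv := fun h => hi (Finset.mem_sdiff.mpr ⟨h, hiK⟩)
      rw [Finset.mem_union, not_or] at hi'
      have ht : ∀ j : K, ⟪b i, T (b j)⟫_𝕜 = 0 := fun j => by
        refine matrix_eq_zero_of_not_mem_band b T nbr hTband fun hji => hi'.1 ?_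
        exact Finset.mem_biUnion.mpr ⟨j, j.2, (hsymm i j).mp hji⟩
      rw [hvc i hi'.2, mul_zero, add_zero, neg_eq_zero]
      exact Finset.sum_eq_zero fun j _ => by rw [ht j, zero_mul, zero_mul]
  have hnorm : ‖X‖ ^ 2 = ∑ i ∈ (K.biUnion nbr ∪ Kv) \ K,
      ‖-∑ j : K, (⟪b i, T (b j)⟫_𝕜 * ((x₀ : 𝕜) - (ℓ j : 𝕜))) * z j + ζ * ⟪b i, vc⟫_𝕜‖ ^ 2 := by
    rw [norm_sq_eq_sum_of_support b _ hsupp]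
    refine Finset.sum_congr rfl fun i hi => ?_
    rw [hXi, if_neg (Finset.mem_sdiff.mp hi).2]
  have h2 : ‖X‖ ^ 2 ≤ (βC * ‖WithLp.toLp 2 (y, g)‖) ^ 2 := by
    rw [hnorm, mul_pow, BorderedHeadTailBound.norm_toLp_sq, ← sum_univ_norm_sq_inner_eq b K hy]
    exact hC _ g
  exact (pow_le_pow_iff_left₀ (norm_nonneg _) (by positivity) two_ne_zero).mp h2

/-! ## §4 The tail form of `hcoer`, split: DIAGONAL + PAIRING + CROSS + RANK-ONE ((N4)) -/

omit [DecidableEq ι] in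
/-- **The nested Schur pairing split.** `U` a complete subspace with star projection `P`, `S₀ U ⊆ U`,
`Ainv` linear on `H × 𝕜` with first components in `U`, `R = 1 − T − (x₀ − λ̃) S₀`, `w ∈ Uᗮ` with
`S₀ w ∈ Uᗮ`, column vector `ṽ`. With `a = Ainv (P (R w), 0)` and `a′ = Ainv (P (T w), 0)` (`a = −a′`):
`⟪R w − R a.1 − a.2 • (ṽ − P ṽ), S₀ w⟫ = ⟪w − (x₀ − λ̃) S₀ w, S₀ w⟫ − ⟪T w, S₀ w⟫ − ⟪T a′.1, S₀ w⟫
+ conj(a′.2) ⟪ṽ − P ṽ, S₀ w⟫` — DIAGONAL, PAIRING, CROSS (through the bordered head) and the RANK-ONE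
term of the `ṽ_t` column. -/
theorem schur_pairing_eq_nested (S₀ T : H →L[𝕜] H) (x₀ lt : 𝕜) (U : Submodule 𝕜 H)
    [U.HasOrthogonalProjection] (hS₀U : ∀ z ∈ U, S₀ z ∈ U) (Ainv : (H × 𝕜) →ₗ[𝕜] (H × 𝕜))
    (hAinvU : ∀ (y : H) (g : 𝕜), (Ainv (y, g)).1 ∈ U) (vt : H) {w : H} (hw : w ∈ Uᗮ)
    (hSw : S₀ w ∈ Uᗮ) :
    ⟪((1 : H →L[𝕜] H) - T - (x₀ - lt) • S₀) w -
        ((1 : H →L[𝕜] H) - T - (x₀ - lt) • S₀)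
          (Ainv (U.starProjection (((1 : H →L[𝕜] H) - T - (x₀ - lt) • S₀) w), 0)).1 -
        (Ainv (U.starProjection (((1 : H →L[𝕜] H) - T - (x₀ - lt) • S₀) w), 0)).2 •
          (vt - U.starProjection vt), S₀ w⟫_𝕜 =
      ⟪w - (x₀ - lt) • S₀ w, S₀ w⟫_𝕜 - ⟪T w, S₀ w⟫_𝕜 -
        ⟪T (Ainv (U.starProjection (T w), 0)).1, S₀ w⟫_𝕜 +
        conj (Ainv (U.starProjection (T w), 0)).2 * ⟪vt - U.starProjection vt, S₀ w⟫_𝕜 := by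
  set P := U.starProjection with hP
  set R : H →L[𝕜] H := (1 : H →L[𝕜] H) - T - (x₀ - lt) • S₀ with hR
  have hPw : P w = 0 := (starProjection_apply_eq_zero_iff U).mpr hw
  have hPSw : P (S₀ w) = 0 := (starProjection_apply_eq_zero_iff U).mpr hSw
  have hRw : R w = w - T w - (x₀ - lt) • S₀ w := by
    simp only [hR, sub_apply, FunLike.coe_smul, Pi.smul_apply, one_apply_eq_self]
  have hPRw : P (R w) = -P (T w) := by
    rw [hRw, map_sub, map_sub, map_smul, hPw, hPSw, smul_zero, sub_zero, zero_sub]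
  have ha : Ainv (P (R w), 0) = -Ainv (P (T w), 0) := by
    rw [hPRw, ← map_neg Ainv, Prod.neg_mk, neg_zero]
  set a' := Ainv (P (T w), 0) with ha'
  have ha1 : (Ainv (P (R w), 0)).1 = -a'.1 := by rw [ha, Prod.fst_neg]
  have ha2 : (Ainv (P (R w), 0)).2 = -a'.2 := by rw [ha, Prod.snd_neg]
  have ha'U : a'.1 ∈ U := hAinvU _ _
  -- `⟪R a'.1, S₀ w⟫ = -⟪T a'.1, S₀ w⟫`
  have hRa : ⟪R a'.1, S₀ w⟫_𝕜 = -⟪T a'.1, S₀ w⟫_𝕜 := by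
    have h1 : ⟪a'.1, S₀ w⟫_𝕜 = 0 := inner_right_of_mem_orthogonal ha'U hSw
    have h2 : ⟪S₀ a'.1, S₀ w⟫_𝕜 = 0 := inner_right_of_mem_orthogonal (hS₀U _ ha'U) hSw
    simp only [hR, sub_apply, FunLike.coe_smul, Pi.smul_apply, one_apply_eq_self]
    rw [inner_sub_left, inner_sub_left, inner_smul_left, h1, h2, mul_zero, sub_zero, zero_sub]
  rw [ha1, ha2, map_neg, neg_smul, hRw]
  simp only [inner_sub_left, inner_add_left, inner_smul_left, sub_neg_eq_add]
  rw [hRa]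
  ring

omit [DecidableEq ι] in
/-- **DIAGONAL part for a complex spectral parameter** (class I rows): for `S₀ = diag(d)`,
`d_i (x₀ − ℓ_i) = 1`, `Re ⟪w − (x₀ − λ̃) S₀ w, S₀ w⟫ = Σ_i (Re λ̃ − ℓ_i) |⟪b i, S₀ w⟫|²` (as a
`HasSum`; instab4's `SkewCutGalerkinTailForm.hasSum_diagonal_pairing` is the case `λ̃ ∈ ℝ`). -/
theorem hasSum_diagonal_pairing_re [CompleteSpace H] (ℓ : ι → ℝ) (x₀ : ℝ)
    (d : lp (fun _ : ι => 𝕜) ⊤) (hd : ∀ i, d i * ((x₀ : 𝕜) - (ℓ i : 𝕜)) = 1) (lt : 𝕜) (w : H) :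
    HasSum (fun i => (RCLike.re lt - ℓ i) * ‖⟪b i, b.diagonalCLM d w⟫_𝕜‖ ^ 2)
      (RCLike.re ⟪w - ((x₀ : 𝕜) - lt) • b.diagonalCLM d w, b.diagonalCLM d w⟫_𝕜) := by
  set v : H := b.diagonalCLM d w with hv
  have hwi : ∀ i, ⟪b i, w⟫_𝕜 = ((x₀ : 𝕜) - (ℓ i : 𝕜)) * ⟪b i, v⟫_𝕜 := fun i => by
    rw [← b.repr_apply_apply v, hv, b.diagonalCLM_apply_repr, b.repr_apply_apply, ← mul_assoc,
      mul_comm ((x₀ : 𝕜) - (ℓ i : 𝕜)), hd, one_mul]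
  have hxi : ∀ i, ⟪b i, w - ((x₀ : 𝕜) - lt) • v⟫_𝕜 = (lt - (ℓ i : 𝕜)) * ⟪b i, v⟫_𝕜 := by
    intro i
    rw [inner_sub_right, inner_smul_right, hwi i]
    ring
  have key : ∀ (c z : 𝕜), RCLike.re ((starRingEnd 𝕜) (c * z) * z) = RCLike.re c * ‖z‖ ^ 2 := by
    intro c z
    rw [map_mul (starRingEnd 𝕜), mul_assoc, RCLike.conj_mul, ← RCLike.ofReal_pow,
      RCLike.re_mul_ofReal, RCLike.conj_re]
  set x' : H := w - ((x₀ : 𝕜) - lt) • v with hx'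
  have hP := b.hasSum_inner_mul_inner x' v
  have hre := RCLike.hasSum_re _ hP
  refine hre.congr_fun fun i => ?_
  have hci : ⟪x', b i⟫_𝕜 = (starRingEnd 𝕜) ⟪b i, x'⟫_𝕜 := (inner_conj_symm _ _).symm
  rw [hci, hxi i, key, map_sub, RCLike.ofReal_re]

omit [DecidableEq ι] in
/-- **STEP 1–2 ⇒ the nested tail coercivity `hcoer` of p456694, with `μ = MU2 − g_B ‖ṽ_t‖` ((N4)).**
Diagonal setting; tail vector `w ∈ Uᗮ` (`v = S₀ w ∈ Uᗮ`); every basis vector in `U` or in `Uᗮ`;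
PAIRING bound `Re ⟪T w, v⟫ ≤ s ‖v‖²` ((F1)+(F2), Lemma S); certified SHELL inequality on a finite `sh`
with the CROSS term through the bordered head included (`a′ = Ainv (P (T w), 0)`); TAIL CONSTANT
`MU2 ≤ Re λ̃ − ℓ_i − s` off the head and the shell; RANK-ONE bound `|a′.2| ≤ g_B ‖v‖` (the certified
`‖B*_{K₀} g‖ = ‖e_μ* Â₀⁻¹ [B ; 0]‖`). Then
`(MU2 − g_B ‖ṽ − P ṽ‖) ‖v‖² ≤ Re ⟪R w − R a.1 − a.2 • (ṽ − P ṽ), v⟫`, `a = Ainv (P (R w), 0)`. -/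
theorem tail_coercive_of_structure_nested [CompleteSpace H] (ℓ : ι → ℝ) (x₀ : ℝ)
    (d : lp (fun _ : ι => 𝕜) ⊤) (hd : ∀ i, d i * ((x₀ : 𝕜) - (ℓ i : 𝕜)) = 1) (T : H →L[𝕜] H)
    (lt : 𝕜) (U : Submodule 𝕜 H) [U.HasOrthogonalProjection]
    (hS₀U : ∀ z ∈ U, b.diagonalCLM d z ∈ U) (Ainv : (H × 𝕜) →ₗ[𝕜] (H × 𝕜))
    (hAinvU : ∀ (y : H) (g : 𝕜), (Ainv (y, g)).1 ∈ U) (vt : H) {w : H} (hw : w ∈ Uᗮ)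
    (hSw : b.diagonalCLM d w ∈ Uᗮ) (hhead : ∀ i, b i ∈ U ∨ b i ∈ Uᗮ)
    {s MU2 gB : ℝ} (hgB : 0 ≤ gB) (sh : Finset ι)
    (hpair : RCLike.re ⟪T w, b.diagonalCLM d w⟫_𝕜 ≤ s * ‖b.diagonalCLM d w‖ ^ 2)
    (hshell : MU2 * ∑ i ∈ sh, ‖⟪b i, b.diagonalCLM d w⟫_𝕜‖ ^ 2 ≤
      ∑ i ∈ sh, (RCLike.re lt - ℓ i - s) * ‖⟪b i, b.diagonalCLM d w⟫_𝕜‖ ^ 2 -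
        RCLike.re ⟪T (Ainv (U.starProjection (T w), 0)).1, b.diagonalCLM d w⟫_𝕜)
    (htail : ∀ i, b i ∉ U → i ∉ sh → MU2 ≤ RCLike.re lt - ℓ i - s)
    (hrank : ‖(Ainv (U.starProjection (T w), 0)).2‖ ≤ gB * ‖b.diagonalCLM d w‖) :
    (MU2 - gB * ‖vt - U.starProjection vt‖) * ‖b.diagonalCLM d w‖ ^ 2 ≤
      RCLike.re ⟪((1 : H →L[𝕜] H) - T - ((x₀ : 𝕜) - lt) • b.diagonalCLM d) w -
        ((1 : H →L[𝕜] H) - T - ((x₀ : 𝕜) - lt) • b.diagonalCLM d)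
          (Ainv (U.starProjection (((1 : H →L[𝕜] H) - T - ((x₀ : 𝕜) - lt) •
            b.diagonalCLM d) w), 0)).1 -
        (Ainv (U.starProjection (((1 : H →L[𝕜] H) - T - ((x₀ : 𝕜) - lt) •
            b.diagonalCLM d) w), 0)).2 • (vt - U.starProjection vt), b.diagonalCLM d w⟫_𝕜 := by
  set S₀ : H →L[𝕜] H := b.diagonalCLM d with hS₀
  set v : H := S₀ w with hv
  set c : ι → ℝ := fun i => ‖⟪b i, v⟫_𝕜‖ ^ 2 with hc
  have hc0 : ∀ i, 0 ≤ c i := fun i => sq_nonneg _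
  have hchead : ∀ i, b i ∈ U → c i = 0 := fun i hi => by
    simp only [hc]
    rw [inner_right_of_mem_orthogonal hi hSw, norm_zero]
    norm_num
  have hnorm : HasSum c (‖v‖ ^ 2) := by
    have h := b.hasSum_inner_mul_inner v v
    have hre := RCLike.hasSum_re _ h
    rw [← InnerProductSpace.norm_sq_eq_re_inner (𝕜 := 𝕜)] at hre
    refine hre.congr_fun fun i => ?_
    simp only [hc]
    have hci : ⟪v, b i⟫_𝕜 = (starRingEnd 𝕜) ⟪b i, v⟫_𝕜 := (inner_conj_symm _ _).symm
    rw [hci, RCLike.conj_mul, ← RCLike.ofReal_pow, RCLike.ofReal_re]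
  have hdiag := hasSum_diagonal_pairing_re b ℓ x₀ d hd lt w
  rw [schur_pairing_eq_nested S₀ T (x₀ : 𝕜) lt U hS₀U Ainv hAinvU vt hw hSw, map_add, map_sub,
    map_sub]
  set a' := Ainv (U.starProjection (T w), 0) with ha'
  set cross : ℝ := RCLike.re ⟪T a'.1, v⟫_𝕜 with hcross
  -- the rank-one term
  have hrank' : -(gB * ‖vt - U.starProjection vt‖ * ‖v‖ ^ 2) ≤
      RCLike.re (conj a'.2 * ⟪vt - U.starProjection vt, v⟫_𝕜) := by
    have h1 : ‖conj a'.2 * ⟪vt - U.starProjection vt, v⟫_𝕜‖ ≤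
        gB * ‖vt - U.starProjection vt‖ * ‖v‖ ^ 2 := by
      rw [norm_mul, RCLike.norm_conj]
      calc ‖a'.2‖ * ‖⟪vt - U.starProjection vt, v⟫_𝕜‖
          ≤ (gB * ‖v‖) * (‖vt - U.starProjection vt‖ * ‖v‖) :=
            mul_le_mul hrank (norm_inner_le_norm _ _) (norm_nonneg _) (by positivity)
        _ = gB * ‖vt - U.starProjection vt‖ * ‖v‖ ^ 2 := by ring
    have h2 := (RCLike.abs_re_le_norm (conj a'.2 * ⟪vt - U.starProjection vt, v⟫_𝕜)).trans h1
    exact (abs_le.mp h2).1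
  -- DIAGONAL + PAIRING + CROSS ≥ MU2 ‖v‖² (as in `SkewCutGalerkinTailForm.tail_coercive_of_structure`)
  have hsum1 : HasSum (fun i => (RCLike.re lt - ℓ i - s) * c i)
      (RCLike.re ⟪w - ((x₀ : 𝕜) - lt) • v, v⟫_𝕜 - s * ‖v‖ ^ 2) := by
    have := hdiag.sub (hnorm.mul_left s)
    refine this.congr_fun fun i => ?_
    simp only [hc]; ring
  have hsplit1 := hsum1.summable.sum_add_tsum_compl (s := sh)
  have hsplit2 := hnorm.summable.sum_add_tsum_compl (s := sh)
  rw [hsum1.tsum_eq] at hsplit1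
  rw [hnorm.tsum_eq] at hsplit2
  have hcompl : MU2 * ∑' i : ↑((sh : Set ι)ᶜ), c i ≤
      ∑' i : ↑((sh : Set ι)ᶜ), (RCLike.re lt - ℓ i - s) * c i := by
    rw [← tsum_mul_left]
    refine Summable.tsum_le_tsum (fun i => ?_) ((hnorm.summable.subtype _).mul_left MU2)
      (hsum1.summable.subtype _)
    obtain ⟨i, hi⟩ := i
    have hi' : i ∉ sh := by simpa using hi
    rcases hhead i with hU | hU
    · simp [hchead i hU]
    · have hnot : b i ∉ U := fun hbU => by
        have := inner_left_of_mem_orthogonal hbU hU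
        rw [inner_self_eq_zero] at this
        exact (b.orthonormal.ne_zero i) this
      exact mul_le_mul_of_nonneg_right (htail i hnot hi') (hc0 i)
  have hshell' : MU2 * ∑ i ∈ sh, c i ≤ ∑ i ∈ sh, (RCLike.re lt - ℓ i - s) * c i - cross := hshell
  have hmain : MU2 * ‖v‖ ^ 2 ≤
      RCLike.re ⟪w - ((x₀ : 𝕜) - lt) • v, v⟫_𝕜 - RCLike.re ⟪T w, v⟫_𝕜 - cross := by
    calc MU2 * ‖v‖ ^ 2 = MU2 * ∑ i ∈ sh, c i + MU2 * ∑' i : ↑((sh : Set ι)ᶜ), c i := by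
          rw [← mul_add, hsplit2]
      _ ≤ (∑ i ∈ sh, (RCLike.re lt - ℓ i - s) * c i - cross) +
            ∑' i : ↑((sh : Set ι)ᶜ), (RCLike.re lt - ℓ i - s) * c i := add_le_add hshell' hcompl
      _ = RCLike.re ⟪w - ((x₀ : 𝕜) - lt) • v, v⟫_𝕜 - s * ‖v‖ ^ 2 - cross := by
          rw [← hsplit1]; ring
      _ ≤ RCLike.re ⟪w - ((x₀ : 𝕜) - lt) • v, v⟫_𝕜 - RCLike.re ⟪T w, v⟫_𝕜 - cross := by
          linarith [hpair]
  have : (MU2 - gB * ‖vt - U.starProjection vt‖) * ‖v‖ ^ 2 =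
      MU2 * ‖v‖ ^ 2 + -(gB * ‖vt - U.starProjection vt‖ * ‖v‖ ^ 2) := by ring
  rw [this]
  exact add_le_add hmain hrank'

end Summit.NavierStokesRegularity.FluidComputer.BorderedEigenpairSectionsBand

end
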